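import Summits.Ventures.Crystal3D.Theorems.StickyWulffConstantTextureLiminfTexShadowAtGlue
import Summits.Ventures.Crystal3D.Theorems.StickyWulffConstantTextureLiminfTexShadowSplitDefsV5
import HarnessLib

/-!
# TexShadow at LAW v5 — the `At R₀` glue RE-DERIVED AT A GENERIC CHARGE CAP `c₀ ≤ 1` (T-V5 PORT, file P4)
# (lane T; crux `TextureLiminfV5`, stmt-Ventures-23912; cf-p1 g30 memo HOME/cf-p1/T-V5-PORT.md P4; v6.20 glue = `…TexShadowAtGlue`)

HONEST FRAMING. Venture `Summits/Ventures/Crystal3D` (cell `crystal3d-full`), route `route-Ventures-StickyWulffConstant`, helper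
`--supports` the law-v5 crux `TextureLiminfV5` (stmt-Ventures-23912).  Pure bookkeeping (census-free, standard axioms); nothing about
the open wall inputs is claimed; rung F-C1 not moved.

The v6.20 composition `bilayerWall_of_stubsAt` (wulff-p2 g16, p681507) at ONE thickness `R₀ ≥ 10`, with every owed input and every
way station taken AT CAP `c₀` (`…TexShadowSplitDefsV5`) and every CLOSED strong cell (F-U `CoaxialUnifAt`, the zero cell, lane G's
(β-i)/(β-ii) payer pools, walker-covered, row-covered at `FramesApart`, zig-frames-apart, `bilayerWallAt_of_payerBound`) consumed through
`bilayerChargeAdmissible_of_at` — SAME PROOFS as the v6.19/v6.20 files (`…FamCoaxialAssembly`, `…AtGlue`, `…PresentationFlip`,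
`…DeficitMinDefs`) with that one insertion; the shared/twin coincidence classes are fed from the co-axial class on the spot
(`coaxialClass_of_sharedClass` / `…twinClass`, zig versions), so no cap-`c₀` twin of them is needed:
* `bilayerWallAt_of_bothFcc_betaIIIAt`, `onReachCoaxialAt_of_split`, `zigCoaxialAt_of_split`, `famCoaxialCharged_of_dispatch`;
* `onReachWeakZigAt_of_zigSplit`, `onReachAllAt_of_split`, `onReachAllCharged_of_classesAt`; `onReachAllAt_flip₁/₂/₁₂`;
* `genericAt_of_four_min`, `deficitMinCharged_of_pool`, `bilayerWallCharged_of_splitAt`, **`bilayerWallCharged_of_stubsAt`**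
  (every `c₀ ≤ 1`, every `R₀ ≥ 10`);
* the law-v5 instances under the memo's names: `famCoaxialAtV5_of_dispatch`, `bilayerWallOnReachAllV5_of_classesAt`,
  `bilayerWallDeficitMinAtV5_of_pool`, **`bilayerWallV5_of_stubsAt : E1-data → StarPairFar-facts → 10 ≤ R₀ → (∃ C, CoaxialUnifAt C R₀) →
  (∃ C, BilayerWallBetaIIIAt (13/25) C R₀) → T-F2-At(13/25) → (∃ C, HStripPayerPoolAt (13/25) C R₀) → (∃ C, BilayerWallResidualAt (13/25) C R₀)
  → BilayerWallV5`**.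
WHAT THIS IS NOT: no proof of F-U, (β-iii), T-F2, the payer pool or the residual at any cap; F-C1 not moved.
-/

noncomputable section

namespace Summit.Ventures.Crystal3D.Cruxes.TextureLiminf.TexShadow

open Summit.Ventures.Crystal3D Summit.Ventures.Crystal3D.Theorems Finset TentCertificate
open Literature.MathematicalPhysics.StatisticalMechanics (IsHaggSeq constHagg isHaggSeq_const fccStacking barlowStacking basalMirror)
open scoped InnerProductSpace

/-! ## The `BothFcc` dispatcher and the co-axial family class at cap `c₀` -/

open scoped Classical in
/-- **The `BothFcc` dispatcher with the (β-iii) carve-out AT CAP `c₀`** (`bilayerWallAt_of_bothFcc_betaIII` verbatim; the zero cell,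
F-U's matrix and lane G's payer pools are consumed through `bilayerChargeAdmissible_of_at`, the carve-out at cap `c₀` directly). -/
theorem bilayerWallAt_of_bothFcc_betaIIIAt
    {s₀ : E3} (hs₀ : s₀ ∈ fccSlots) (hcert : ExactOnly 0 (fccSlots.filter fun w => 0 < ⟪w, s₀⟫_ℝ))
    (hDS : ∀ G₁ G₂ : E3 ≃ₗᵢ[ℝ] E3, DoubleStarCoaxialAt G₁ G₂) (hCP : CapPairCoaxial)
    {c₀ R₀ C_F C₃ : ℝ} (hc₀ : c₀ ≤ 1) (hR₀ : 10 ≤ R₀) (hFU : CoaxialUnifAt C_F R₀) (hIII : BilayerWallBetaIIIAt c₀ C₃ R₀)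
    {σ₁ σ₂ : ℤ → ℤ} (hσ₁ : IsHaggSeq σ₁) (hσ₂ : IsHaggSeq σ₂) (hfcc : BothFcc σ₁ σ₂)
    (L₁ L₂ : E3 ≃ₗᵢ[ℝ] E3) (s₁ s₂ : E3) {A₁ A₂ : ℤ → (E3 ≃ₗᵢ[ℝ] E3)} {u₁ u₂ : ℤ → E3}
    (hfr₁ : BilayerFramesAt L₁ s₁ σ₁ A₁ u₁) (hfr₂ : BilayerFramesAt L₂ s₂ σ₂ A₂ u₂)
    (hgen : ∀ i j : ℤ, ¬ InResidualClass (A₁ i) (A₂ j) (u₁ i) (u₂ j))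
    {c : ℤ → ℤ → ℝ} {m : ℤ → ℤ → E3} (hadm : BilayerChargeAdmissibleAt c₀ A₁ A₂ c m) :
    BilayerWallAt (max (max (C_F + 60 * Real.sqrt 2 * Real.pi) ((2 * 2000 * (1 + 2 * (R₀ - 10)) + 3456 + 1152 * (R₀ + 1)) / 2)) C₃)
      R₀ σ₁ σ₂ L₁ L₂ s₁ s₂ c := by
  have hadm₁ : BilayerChargeAdmissible A₁ A₂ c m := bilayerChargeAdmissible_of_at hc₀ hadm
  obtain ⟨P₁, P₂, -, -, hS₁, hS₂⟩ := exists_affine_fcc_pair_of_bothFcc L₁ L₂ s₁ s₂ hσ₁ hσ₂ hfcc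
  have hR0 : 0 ≤ R₀ := by linarith
  have hR1 : 1 ≤ R₀ := by linarith
  have hR3 : 3 ≤ R₀ := by linarith
  by_cases hco : CoAx P₁ P₂
  · by_cases hlin : P₁ '' fccRef = P₂ '' fccRef
    · -- (α=) zero cell
      have hz := bilayerWallAt_of_equal_linear hσ₁ hσ₂ hS₁ hS₂ hfr₁ hfr₂ hadm₁ hlin R₀ hR3
      refine bilayerWallAt_mono hR0 (le_trans ?_ (le_trans (le_max_right _ _) (le_max_left _ _))) hz
      have : 0 ≤ 2 * 2000 * (1 + 2 * (R₀ - 10)) := by nlinarith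
      linarith
    · -- (α≠) lane F's uniform matrix
      obtain ⟨L, r₁, r₂, τ, τ', hτ, hτ', h₁, h₂, hcell⟩ :=
        hFU P₁ s₁ P₂ s₂ (affine_coax_of_coAx s₁ s₂ hco) (affine_ne_of_linear_ne hσ₁ hS₁ hlin)
      exact bilayerWallAt_mono hR0 (le_trans (le_max_left _ _) (le_max_left _ _))
        (bilayerWallAt_of_coaxialCell hσ₁ hσ₂ hS₁ hS₂ hfr₁ hfr₂ hadm₁ hτ hτ' h₁ h₂ hR1 hcell)
  · by_cases hβ : (¬ Sigma9OneSidedAt (A₁ 0) (A₂ 0) ∧ ¬ Sigma9OneSidedDownAt (A₁ 0) (A₂ 0) ∧ ¬ Sigma9TiltAt (A₁ 0) (A₂ 0) ∧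
      ¬ Sigma9TiltDownAt (A₁ 0) (A₂ 0) ∧ ¬ Sigma9WideAt (A₁ 0) (A₂ 0) ∧ ¬ Sigma9WideDownAt (A₁ 0) (A₂ 0) ∧
      ¬ SeparatedWideAt (A₁ 0) (A₂ 0))
    · -- (β-i/ii) lane G's payer pools
      exact bilayerWallAt_mono hR0 (le_trans (le_max_right _ _) (le_max_left _ _))
        (bilayerWallAt_of_not_coAx_offSigma9 hs₀ hcert hDS hCP hσ₁ hσ₂ hS₁ hS₂ hfr₁ hfr₂ hadm₁ hco (hgen 0 0) hβ hR₀)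
    · -- (β-iii) the named carve-out, at cap `c₀`
      have hco' : ¬ CoAx (A₁ 0) (A₂ 0) := by
        rw [coAx_congr (bilayerFrame_image_eq hσ₁ hS₁ hfr₁ 0) (bilayerFrame_image_eq hσ₂ hS₂ hfr₂ 0)]; exact hco
      have hcells : Sigma9OneSidedAt (A₁ 0) (A₂ 0) ∨ Sigma9OneSidedDownAt (A₁ 0) (A₂ 0) ∨ Sigma9TiltAt (A₁ 0) (A₂ 0) ∨
          Sigma9TiltDownAt (A₁ 0) (A₂ 0) ∨ Sigma9WideAt (A₁ 0) (A₂ 0) ∨ Sigma9WideDownAt (A₁ 0) (A₂ 0) ∨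
          SeparatedWideAt (A₁ 0) (A₂ 0) := by
        by_contra h
        push Not at h
        exact hβ h
      exact bilayerWallAt_mono hR0 (le_max_right _ _)
        (hIII σ₁ σ₂ hσ₁ hσ₂ hfcc L₁ L₂ s₁ s₂ A₁ A₂ u₁ u₂ hfr₁ hfr₂ hgen c m hadm hco' hcells)

open scoped Classical in
/-- **O3 at cap `c₀` at one thickness from the split** (`BothFcc` by the dispatcher, `¬BothFcc` by T-F2's corner-keyed half at cap `c₀`). -/
theorem onReachCoaxialAt_of_split
    {s₀ : E3} (hs₀ : s₀ ∈ fccSlots) (hcert : ExactOnly 0 (fccSlots.filter fun w => 0 < ⟪w, s₀⟫_ℝ))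
    (hDS : ∀ G₁ G₂ : E3 ≃ₗᵢ[ℝ] E3, DoubleStarCoaxialAt G₁ G₂) (hCP : CapPairCoaxial)
    {c₀ R₀ C_F C₃ C_f : ℝ} (hc₀ : c₀ ≤ 1) (hR₀ : 10 ≤ R₀) (hFU : CoaxialUnifAt C_F R₀) (hIII : BilayerWallBetaIIIAt c₀ C₃ R₀)
    (hf : BilayerWallFaultedOnReachCoaxialAt c₀ C_f R₀) :
    BilayerWallOnReachCoaxialAt c₀
      (max (max (max (C_F + 60 * Real.sqrt 2 * Real.pi) ((2 * 2000 * (1 + 2 * (R₀ - 10)) + 3456 + 1152 * (R₀ + 1)) / 2)) C₃) C_f)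
      R₀ := by
  intro σ₁ σ₂ hσ₁ hσ₂ L₁ L₂ s₁ s₂ A₁ A₂ u₁ u₂ hA₁ hA₂ hgen c m hadm hdom hcl
  have hR0 : 0 ≤ R₀ := by linarith
  by_cases hfcc : BothFcc σ₁ σ₂
  · exact bilayerWallAt_mono hR0 (le_max_left _ _)
      (bilayerWallAt_of_bothFcc_betaIIIAt hs₀ hcert hDS hCP hc₀ hR₀ hFU hIII hσ₁ hσ₂ hfcc L₁ L₂ s₁ s₂ hA₁ hA₂ hgen hadm)
  · exact bilayerWallAt_mono hR0 (le_max_right _ _)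
      (hf σ₁ σ₂ hσ₁ hσ₂ hfcc L₁ L₂ s₁ s₂ A₁ A₂ u₁ u₂ hA₁ hA₂ hgen c m hadm hdom hcl)

open scoped Classical in
/-- **ZO3 at cap `c₀` at one thickness from the split.** -/
theorem zigCoaxialAt_of_split
    {s₀ : E3} (hs₀ : s₀ ∈ fccSlots) (hcert : ExactOnly 0 (fccSlots.filter fun w => 0 < ⟪w, s₀⟫_ℝ))
    (hDS : ∀ G₁ G₂ : E3 ≃ₗᵢ[ℝ] E3, DoubleStarCoaxialAt G₁ G₂) (hCP : CapPairCoaxial)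
    {c₀ R₀ C_F C₃ C_f : ℝ} (hc₀ : c₀ ≤ 1) (hR₀ : 10 ≤ R₀) (hFU : CoaxialUnifAt C_F R₀) (hIII : BilayerWallBetaIIIAt c₀ C₃ R₀)
    (hf : BilayerWallFaultedZigCoaxialAt c₀ C_f R₀) :
    BilayerWallZigCoaxialAt c₀
      (max (max (max (C_F + 60 * Real.sqrt 2 * Real.pi) ((2 * 2000 * (1 + 2 * (R₀ - 10)) + 3456 + 1152 * (R₀ + 1)) / 2)) C₃) C_f)
      R₀ := by
  intro σ₁ σ₂ hσ₁ hσ₂ L₁ L₂ s₁ s₂ A₁ A₂ u₁ u₂ hA₁ hA₂ hgen c m hadm hΔ₁ hΔ₂ hfl hoff hrow hzg hcl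
  have hR0 : 0 ≤ R₀ := by linarith
  by_cases hfcc : BothFcc σ₁ σ₂
  · exact bilayerWallAt_mono hR0 (le_max_left _ _)
      (bilayerWallAt_of_bothFcc_betaIIIAt hs₀ hcert hDS hCP hc₀ hR₀ hFU hIII hσ₁ hσ₂ hfcc L₁ L₂ s₁ s₂ hA₁ hA₂ hgen hadm)
  · exact bilayerWallAt_mono hR0 (le_max_right _ _)
      (hf σ₁ σ₂ hσ₁ hσ₂ hfcc L₁ L₂ s₁ s₂ A₁ A₂ u₁ u₂ hA₁ hA₂ hgen c m hadm hΔ₁ hΔ₂ hfl hoff hrow hzg hcl)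

/-- **The co-axial family class at cap `c₀` at one `R₀ ≥ 10`** from F-U (strong), (β-iii) at cap `c₀` and T-F2 at cap `c₀`. -/
theorem famCoaxialCharged_of_dispatch
    {s₀ : E3} (hs₀ : s₀ ∈ fccSlots) (hcert : ExactOnly 0 (fccSlots.filter fun w => 0 < ⟪w, s₀⟫_ℝ))
    (hDS : ∀ G₁ G₂ : E3 ≃ₗᵢ[ℝ] E3, DoubleStarCoaxialAt G₁ G₂) (hCP : CapPairCoaxial) {c₀ R₀ : ℝ} (hc₀ : c₀ ≤ 1)
    (h10 : 10 ≤ R₀) (hF : ∃ C : ℝ, CoaxialUnifAt C R₀) (hIII : ∃ C : ℝ, BilayerWallBetaIIIAt c₀ C R₀)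
    (hFault : (∃ C : ℝ, BilayerWallFaultedOnReachCoaxialAt c₀ C R₀) ∧ (∃ C : ℝ, BilayerWallFaultedZigCoaxialAt c₀ C R₀)) :
    (∃ C : ℝ, BilayerWallOnReachCoaxialAt c₀ C R₀) ∧ (∃ C : ℝ, BilayerWallZigCoaxialAt c₀ C R₀) := by
  obtain ⟨C_F, hFU⟩ := hF
  obtain ⟨C₃, h₃⟩ := hIII
  obtain ⟨⟨C_f, hf⟩, ⟨C_z, hz⟩⟩ := hFault
  exact ⟨⟨_, onReachCoaxialAt_of_split hs₀ hcert hDS hCP hc₀ h10 hFU h₃ hf⟩,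
    ⟨_, zigCoaxialAt_of_split hs₀ hcert hDS hCP hc₀ h10 hFU h₃ hz⟩⟩

/-! ## On-reach glue at cap `c₀` at one thickness -/

/-- **Zig-frames-apart (strong) ∪ ZO1 ∪ ZO2 ∪ ZO3 (all three from the co-axial class at cap `c₀`) ⇒ W at cap `c₀`, at one `R₀ ≥ 0`.** -/
theorem onReachWeakZigAt_of_zigSplit {c₀ R₀ C₁ C₄ : ℝ} (hc₀ : c₀ ≤ 1) (hR₀0 : 0 ≤ R₀)
    (hC₁ : BilayerWallZigFramesApart C₁ R₀) (hC₄ : BilayerWallZigCoaxialAt c₀ C₄ R₀) :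
    BilayerWallOnReachWeakZigAt c₀ (max C₁ C₄) R₀ := by
  classical
  intro σ₁ σ₂ hσ₁ hσ₂ L₁ L₂ s₁ s₂ A₁ A₂ u₁ u₂ hu₁ hu₂ hgen c m hadm hΔ₁ hΔ₂ hFD hBOR hRow hZG
  by_cases hZA : ZigFramesApart L₁ s₁ σ₁ L₂ s₂ σ₂
  · exact bilayerWallAt_mono hR₀0 (le_max_left _ _)
      (hC₁ σ₁ σ₂ hσ₁ hσ₂ L₁ L₂ s₁ s₂ A₁ A₂ u₁ u₂ hu₁ hu₂ hgen hΔ₁ hΔ₂ hZA c m (bilayerChargeAdmissible_of_at hc₀ hadm) hFD)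
  · have hcl : ∃ F₁ ∈ zigFrames L₁ e₃, ∃ F₂ ∈ zigFrames L₂ (-e₃), CoAxFrames F₁ F₂ := by
      rcases zigFrameClasses_of_not_zigFramesApart hZA with h | h | h
      · exact zigCoaxialClass_of_zigSharedClass h
      · exact zigCoaxialClass_of_zigTwinClass h
      · exact h
    exact bilayerWallAt_mono hR₀0 (le_max_right _ _)
      (hC₄ σ₁ σ₂ hσ₁ hσ₂ L₁ L₂ s₁ s₂ A₁ A₂ u₁ u₂ hu₁ hu₂ hgen c m hadm hΔ₁ hΔ₂ hFD hBOR hRow hZG hcl)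

/-- **Row-covered (strong) ∪ zig-apart (strong) ∪ O1 ∪ O2 ∪ O3 (from the co-axial class at cap `c₀`) ∪ W (cap `c₀`) ⇒ on-reach-all at
cap `c₀`, `OffR := FramesApart`, at one `R₀ ≥ 0`** (`bilayerWallOnReachAll_of_splitAt`'s `by_cases` tree). -/
theorem onReachAllAt_of_split {c₀ R₀ C₁ C₂ C₅ C₆ : ℝ} (hc₀ : c₀ ≤ 1) (hR₀0 : 0 ≤ R₀)
    (hC₁ : BilayerWallRowCov FramesApart C₁ R₀) (hC₂ : BilayerWallZigApart C₂ R₀)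
    (hC₅ : BilayerWallOnReachCoaxialAt c₀ C₅ R₀) (hC₆ : BilayerWallOnReachWeakZigAt c₀ C₆ R₀) :
    BilayerWallOnReachAllAt FramesApart c₀ (max (max C₁ C₂) (max C₅ C₆)) R₀ := by
  classical
  set C : ℝ := max (max C₁ C₂) (max C₅ C₆) with hCdef
  have e1 : C₁ ≤ C := le_trans (le_max_left _ _) (le_max_left _ _)
  have e2 : C₂ ≤ C := le_trans (le_max_right _ _) (le_max_left _ _)
  have e5 : C₅ ≤ C := le_trans (le_max_left _ _) (le_max_right _ _)
  have e6 : C₆ ≤ C := le_trans (le_max_right _ _) (le_max_right _ _)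
  intro σ₁ σ₂ hσ₁ hσ₂ L₁ L₂ s₁ s₂ A₁ A₂ u₁ u₂ hu₁ hu₂ hgen c m hadm H
  have hadm₁ : BilayerChargeAdmissible A₁ A₂ c m := bilayerChargeAdmissible_of_at hc₀ hadm
  -- the three frame classes are ONE co-axial class, for a dominated table
  have classes : DomBy L₁ σ₁ L₂ σ₂ c → ¬ FramesApart L₁ s₁ σ₁ L₂ s₂ σ₂ → BilayerWallAt C R₀ σ₁ σ₂ L₁ L₂ s₁ s₂ c := by
    intro hdom hFA
    have hcl : ∃ F₁ ∈ cornerFrames L₁ σ₁ e₃, ∃ F₂ ∈ cornerFrames L₂ σ₂ (-e₃), CoAxFrames F₁ F₂ := by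
      rcases frameClasses_of_not_framesApart hFA with h | h | h
      · exact coaxialClass_of_sharedClass h
      · exact coaxialClass_of_twinClass h
      · exact h
    exact bilayerWallAt_mono hR₀0 e5 (hC₅ σ₁ σ₂ hσ₁ hσ₂ L₁ L₂ s₁ s₂ A₁ A₂ u₁ u₂ hu₁ hu₂ hgen c m hadm hdom hcl)
  by_cases hRow : RowMixDominated (Real.sqrt 2 / 2) L₁ σ₁ L₂ σ₂ c
  · by_cases hFA : FramesApart L₁ s₁ σ₁ L₂ s₂ σ₂
    · exact bilayerWallAt_mono hR₀0 e1 (hC₁ σ₁ σ₂ hσ₁ hσ₂ L₁ L₂ s₁ s₂ A₁ A₂ u₁ u₂ hu₁ hu₂ hgen c m hadm₁ hRow hFA)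
    · exact classes (Or.inr hRow) hFA
  · rcases H with ⟨hS₁, hS₂, hFD, hBOR⟩ | ⟨hRow', -⟩
    · by_cases hZG : ZigGood L₁ σ₁ e₃ ∧ ZigGood L₂ σ₂ (-e₃)
      · by_cases hFA : FramesApart L₁ s₁ σ₁ L₂ s₂ σ₂
        · exact bilayerWallAt_mono hR₀0 e2
            (hC₂ σ₁ σ₂ hσ₁ hσ₂ L₁ L₂ s₁ s₂ A₁ A₂ u₁ u₂ hu₁ hu₂ hgen hZG.1 hZG.2 hFA c m hadm₁ hFD)
        · exact classes (Or.inl ⟨hZG.1, hZG.2, hFD⟩) hFA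
      · exact bilayerWallAt_mono hR₀0 e6
          (hC₆ σ₁ σ₂ hσ₁ hσ₂ L₁ L₂ s₁ s₂ A₁ A₂ u₁ u₂ hu₁ hu₂ hgen c m hadm hS₁ hS₂ hFD hBOR hRow hZG)
    · exact absurd hRow' hRow

/-- **On-reach-all at cap `c₀` at one `R₀ ≥ 6` from the two co-axial classes at cap `c₀`**, the closed parts (row-covered at `FramesApart`,
zig-frames-apart) discharged modulo E1 / StarPairFar, the shared/twin classes folded into the co-axial one. -/
theorem onReachAllCharged_of_classesAt
    {sE : E3} (hsE : sE ∈ fccSlots) (hcert : ExactOnly 0 (fccSlots.filter fun w => 0 < ⟪w, sE⟫_ℝ))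
    (hDS : ∀ F₁ F₂ : E3 ≃ₗᵢ[ℝ] E3, DoubleStarCoaxialAt F₁ F₂) (hCP : CapPairCoaxial) {c₀ R₀ : ℝ} (hc₀ : c₀ ≤ 1) (hR₀ : 6 ≤ R₀)
    (hC : ∃ C, BilayerWallOnReachCoaxialAt c₀ C R₀) (hZC : ∃ C, BilayerWallZigCoaxialAt c₀ C R₀) :
    ∃ C : ℝ, BilayerWallOnReachAllAt FramesApart c₀ C R₀ := by
  have hR₀0 : 0 ≤ R₀ := by linarith
  obtain ⟨C_R, hR⟩ := bilayerWallRowCovFrom_framesApart hsE hcert hDS hCP R₀ hR₀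
  obtain ⟨C_A, hA⟩ := bilayerWallZigFramesApartFrom_of_cert hsE hcert hDS hCP R₀ hR₀
  obtain ⟨C_C, hC⟩ := hC
  obtain ⟨C_ZC, hZC⟩ := hZC
  exact ⟨_, onReachAllAt_of_split hc₀ hR₀0 hR (bilayerWallZigApart_of_zigFramesApart hA) hC
    (onReachWeakZigAt_of_zigSplit hc₀ hR₀0 hA hZC)⟩

/-! ## The on-reach part at cap `c₀` in the flipped presentations -/

/-- **ON-REACH at cap `c₀`, plate 1 flipped** (`onReachAll_flip₁` verbatim with `bilayerChargeAdmissibleAt_flip₁`). -/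
theorem onReachAllAt_flip₁ {OffR : (E3 ≃ₗᵢ[ℝ] E3) → E3 → (ℤ → ℤ) → (E3 ≃ₗᵢ[ℝ] E3) → E3 → (ℤ → ℤ) → Prop} {c₀ C R₀ : ℝ}
    (hOR : BilayerWallOnReachAllAt OffR c₀ C R₀) {σ₁ σ₂ : ℤ → ℤ} (hσ₁ : IsHaggSeq σ₁) (hσ₂ : IsHaggSeq σ₂)
    {L₁ L₂ : E3 ≃ₗᵢ[ℝ] E3} {s₁ s₂ : E3} {A₁ A₂ : ℤ → (E3 ≃ₗᵢ[ℝ] E3)} {u₁ u₂ : ℤ → E3}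
    (hF₁ : BilayerFramesAt L₁ s₁ σ₁ A₁ u₁) (hF₂ : BilayerFramesAt L₂ s₂ σ₂ A₂ u₂)
    (hres : ∀ i j : ℤ, ¬ InResidualClass (A₁ i) (A₂ j) (u₁ i) (u₂ j))
    {c : ℤ → ℤ → ℝ} {m : ℤ → ℤ → E3} (hadm : BilayerChargeAdmissibleAt c₀ A₁ A₂ c m)
    (hon : (DeltaSteep (basalMirror.trans L₁) e₃ ∧ DeltaSteep L₂ (-e₃) ∧
        FluxDominated (Real.sqrt 2 / 2) (basalMirror.trans L₁) (fun n => -σ₁ (-n - 1)) L₂ σ₂ (fun i j => c (-i - 1) j) ∧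
        ¬ BarlowOffReach (basalMirror.trans L₁) s₁ (fun n => -σ₁ (-n - 1)) L₂ s₂ σ₂) ∨
      (RowMixDominated (Real.sqrt 2 / 2) (basalMirror.trans L₁) (fun n => -σ₁ (-n - 1)) L₂ σ₂ (fun i j => c (-i - 1) j) ∧
        ¬ OffR (basalMirror.trans L₁) s₁ (fun n => -σ₁ (-n - 1)) L₂ s₂ σ₂)) :
    BilayerWallAt C R₀ σ₁ σ₂ L₁ L₂ s₁ s₂ c :=
  bilayerWallAt_flip₁.1
    (hOR _ _ (isHaggSeq_reverse hσ₁) hσ₂ _ _ _ _ _ _ _ _ (bilayerFramesAt_flip hF₁) hF₂ (fun _ _ => hres _ _) _ _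
      (bilayerChargeAdmissibleAt_flip₁ hadm) hon)

/-- **ON-REACH at cap `c₀`, plate 2 flipped.** -/
theorem onReachAllAt_flip₂ {OffR : (E3 ≃ₗᵢ[ℝ] E3) → E3 → (ℤ → ℤ) → (E3 ≃ₗᵢ[ℝ] E3) → E3 → (ℤ → ℤ) → Prop} {c₀ C R₀ : ℝ}
    (hOR : BilayerWallOnReachAllAt OffR c₀ C R₀) {σ₁ σ₂ : ℤ → ℤ} (hσ₁ : IsHaggSeq σ₁) (hσ₂ : IsHaggSeq σ₂)
    {L₁ L₂ : E3 ≃ₗᵢ[ℝ] E3} {s₁ s₂ : E3} {A₁ A₂ : ℤ → (E3 ≃ₗᵢ[ℝ] E3)} {u₁ u₂ : ℤ → E3}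
    (hF₁ : BilayerFramesAt L₁ s₁ σ₁ A₁ u₁) (hF₂ : BilayerFramesAt L₂ s₂ σ₂ A₂ u₂)
    (hres : ∀ i j : ℤ, ¬ InResidualClass (A₁ i) (A₂ j) (u₁ i) (u₂ j))
    {c : ℤ → ℤ → ℝ} {m : ℤ → ℤ → E3} (hadm : BilayerChargeAdmissibleAt c₀ A₁ A₂ c m)
    (hon : (DeltaSteep L₁ e₃ ∧ DeltaSteep (basalMirror.trans L₂) (-e₃) ∧
        FluxDominated (Real.sqrt 2 / 2) L₁ σ₁ (basalMirror.trans L₂) (fun n => -σ₂ (-n - 1)) (fun i j => c i (-j - 1)) ∧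
        ¬ BarlowOffReach L₁ s₁ σ₁ (basalMirror.trans L₂) s₂ (fun n => -σ₂ (-n - 1))) ∨
      (RowMixDominated (Real.sqrt 2 / 2) L₁ σ₁ (basalMirror.trans L₂) (fun n => -σ₂ (-n - 1)) (fun i j => c i (-j - 1)) ∧
        ¬ OffR L₁ s₁ σ₁ (basalMirror.trans L₂) s₂ (fun n => -σ₂ (-n - 1)))) :
    BilayerWallAt C R₀ σ₁ σ₂ L₁ L₂ s₁ s₂ c :=
  bilayerWallAt_flip₂.1
    (hOR _ _ hσ₁ (isHaggSeq_reverse hσ₂) _ _ _ _ _ _ _ _ hF₁ (bilayerFramesAt_flip hF₂) (fun _ _ => hres _ _) _ _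
      (bilayerChargeAdmissibleAt_flip₂ hadm) hon)

/-- **ON-REACH at cap `c₀`, both plates flipped.** -/
theorem onReachAllAt_flip₁₂ {OffR : (E3 ≃ₗᵢ[ℝ] E3) → E3 → (ℤ → ℤ) → (E3 ≃ₗᵢ[ℝ] E3) → E3 → (ℤ → ℤ) → Prop} {c₀ C R₀ : ℝ}
    (hOR : BilayerWallOnReachAllAt OffR c₀ C R₀) {σ₁ σ₂ : ℤ → ℤ} (hσ₁ : IsHaggSeq σ₁) (hσ₂ : IsHaggSeq σ₂)
    {L₁ L₂ : E3 ≃ₗᵢ[ℝ] E3} {s₁ s₂ : E3} {A₁ A₂ : ℤ → (E3 ≃ₗᵢ[ℝ] E3)} {u₁ u₂ : ℤ → E3}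
    (hF₁ : BilayerFramesAt L₁ s₁ σ₁ A₁ u₁) (hF₂ : BilayerFramesAt L₂ s₂ σ₂ A₂ u₂)
    (hres : ∀ i j : ℤ, ¬ InResidualClass (A₁ i) (A₂ j) (u₁ i) (u₂ j))
    {c : ℤ → ℤ → ℝ} {m : ℤ → ℤ → E3} (hadm : BilayerChargeAdmissibleAt c₀ A₁ A₂ c m)
    (hon : (DeltaSteep (basalMirror.trans L₁) e₃ ∧ DeltaSteep (basalMirror.trans L₂) (-e₃) ∧
        FluxDominated (Real.sqrt 2 / 2) (basalMirror.trans L₁) (fun n => -σ₁ (-n - 1))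
          (basalMirror.trans L₂) (fun n => -σ₂ (-n - 1)) (fun i j => c (-i - 1) (-j - 1)) ∧
        ¬ BarlowOffReach (basalMirror.trans L₁) s₁ (fun n => -σ₁ (-n - 1)) (basalMirror.trans L₂) s₂ (fun n => -σ₂ (-n - 1))) ∨
      (RowMixDominated (Real.sqrt 2 / 2) (basalMirror.trans L₁) (fun n => -σ₁ (-n - 1))
          (basalMirror.trans L₂) (fun n => -σ₂ (-n - 1)) (fun i j => c (-i - 1) (-j - 1)) ∧
        ¬ OffR (basalMirror.trans L₁) s₁ (fun n => -σ₁ (-n - 1)) (basalMirror.trans L₂) s₂ (fun n => -σ₂ (-n - 1)))) :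
    BilayerWallAt C R₀ σ₁ σ₂ L₁ L₂ s₁ s₂ c :=
  bilayerWallAt_flip₁.1
    (onReachAllAt_flip₂ hOR (isHaggSeq_reverse hσ₁) hσ₂ (bilayerFramesAt_flip hF₁) hF₂ (fun _ _ => hres _ _)
      (bilayerChargeAdmissibleAt_flip₁ hadm) hon)

/-! ## The generic glue and the wall law at cap `c₀` at one thickness -/

/-- **Walker-covered (strong) ∪ row-covered (strong) ∪ on-reach (cap `c₀`) ∪ deficit-MIN (cap `c₀`) ⇒ generic at cap `c₀`, at one
`R₀ ≥ 0`** (`bilayerWallGeneric_of_four_minAt`'s `by_cases` tree verbatim). -/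
theorem genericAt_of_four_min
    {OffR : (E3 ≃ₗᵢ[ℝ] E3) → E3 → (ℤ → ℤ) → (E3 ≃ₗᵢ[ℝ] E3) → E3 → (ℤ → ℤ) → Prop}
    {c₀ R₀ C₁ C₂ C₃ C₄ : ℝ} (hc₀ : c₀ ≤ 1) (hR₀0 : 0 ≤ R₀) (hC₁ : BilayerWallWalkerCovered C₁ R₀)
    (hC₂ : BilayerWallRowCov OffR C₂ R₀) (hC₃ : BilayerWallOnReachAllAt OffR c₀ C₃ R₀) (hC₄ : BilayerWallDeficitMinAt c₀ C₄ R₀) :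
    BilayerWallGenericAt c₀ (max (max C₁ C₂) (max C₃ C₄)) R₀ := by
  classical
  have h2 : C₂ ≤ max (max C₁ C₂) (max C₃ C₄) := le_trans (le_max_right _ _) (le_max_left _ _)
  have h3 : C₃ ≤ max (max C₁ C₂) (max C₃ C₄) := le_trans (le_max_left _ _) (le_max_right _ _)
  intro σ₁ σ₂ hσ₁ hσ₂ L₁ L₂ s₁ s₂ A₁ A₂ u₁ u₂ hu₁ hu₂ hgen c m hadm
  have hadm₁ : BilayerChargeAdmissible A₁ A₂ c m := bilayerChargeAdmissible_of_at hc₀ hadm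
  by_cases hZ : DeltaSteep L₁ e₃ ∧ DeltaSteep L₂ (-e₃) ∧ FluxDominated (Real.sqrt 2 / 2) L₁ σ₁ L₂ σ₂ c
  · by_cases hoff : BarlowOffReach L₁ s₁ σ₁ L₂ s₂ σ₂
    · exact bilayerWallAt_mono hR₀0 (le_trans (le_max_left _ _) (le_max_left _ _))
        (hC₁ σ₁ σ₂ hσ₁ hσ₂ L₁ L₂ s₁ s₂ A₁ A₂ u₁ u₂ hu₁ hu₂ hgen ⟨hZ.1, hZ.2.1, hoff⟩ c m hadm₁ hZ.2.2)
    · exact bilayerWallAt_mono hR₀0 h3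
        (hC₃ σ₁ σ₂ hσ₁ hσ₂ L₁ L₂ s₁ s₂ A₁ A₂ u₁ u₂ hu₁ hu₂ hgen c m hadm (Or.inl ⟨hZ.1, hZ.2.1, hZ.2.2, hoff⟩))
  · by_cases hRow : RowMixDominated (Real.sqrt 2 / 2) L₁ σ₁ L₂ σ₂ c
    · by_cases hoff : OffR L₁ s₁ σ₁ L₂ s₂ σ₂
      · exact bilayerWallAt_mono hR₀0 h2 (hC₂ σ₁ σ₂ hσ₁ hσ₂ L₁ L₂ s₁ s₂ A₁ A₂ u₁ u₂ hu₁ hu₂ hgen c m hadm₁ hRow hoff)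
      · exact bilayerWallAt_mono hR₀0 h3
          (hC₃ σ₁ σ₂ hσ₁ hσ₂ L₁ L₂ s₁ s₂ A₁ A₂ u₁ u₂ hu₁ hu₂ hgen c m hadm (Or.inr ⟨hRow, hoff⟩))
    · by_cases hRow₁ : RowMixDominated (Real.sqrt 2 / 2) (basalMirror.trans L₁) (fun n => -σ₁ (-n - 1)) L₂ σ₂
          (fun i j => c (-i - 1) j)
      · by_cases hoff : OffR (basalMirror.trans L₁) s₁ (fun n => -σ₁ (-n - 1)) L₂ s₂ σ₂
        · exact bilayerWallAt_mono hR₀0 h2 (rowCov_flip₁ hC₂ hσ₁ hσ₂ hu₁ hu₂ hgen hadm₁ hRow₁ hoff)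
        · exact bilayerWallAt_mono hR₀0 h3 (onReachAllAt_flip₁ hC₃ hσ₁ hσ₂ hu₁ hu₂ hgen hadm (Or.inr ⟨hRow₁, hoff⟩))
      · by_cases hRow₂ : RowMixDominated (Real.sqrt 2 / 2) L₁ σ₁ (basalMirror.trans L₂) (fun n => -σ₂ (-n - 1))
            (fun i j => c i (-j - 1))
        · by_cases hoff : OffR L₁ s₁ σ₁ (basalMirror.trans L₂) s₂ (fun n => -σ₂ (-n - 1))
          · exact bilayerWallAt_mono hR₀0 h2 (rowCov_flip₂ hC₂ hσ₁ hσ₂ hu₁ hu₂ hgen hadm₁ hRow₂ hoff)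
          · exact bilayerWallAt_mono hR₀0 h3 (onReachAllAt_flip₂ hC₃ hσ₁ hσ₂ hu₁ hu₂ hgen hadm (Or.inr ⟨hRow₂, hoff⟩))
        · by_cases hRow₁₂ : RowMixDominated (Real.sqrt 2 / 2) (basalMirror.trans L₁) (fun n => -σ₁ (-n - 1))
              (basalMirror.trans L₂) (fun n => -σ₂ (-n - 1)) (fun i j => c (-i - 1) (-j - 1))
          · by_cases hoff : OffR (basalMirror.trans L₁) s₁ (fun n => -σ₁ (-n - 1)) (basalMirror.trans L₂) s₂
                (fun n => -σ₂ (-n - 1))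
            · exact bilayerWallAt_mono hR₀0 h2 (rowCov_flip₁₂ hC₂ hσ₁ hσ₂ hu₁ hu₂ hgen hadm₁ hRow₁₂ hoff)
            · exact bilayerWallAt_mono hR₀0 h3 (onReachAllAt_flip₁₂ hC₃ hσ₁ hσ₂ hu₁ hu₂ hgen hadm (Or.inr ⟨hRow₁₂, hoff⟩))
          · exact bilayerWallAt_mono hR₀0 (le_trans (le_max_right _ _) (le_max_right _ _))
              (hC₄ σ₁ σ₂ hσ₁ hσ₂ L₁ L₂ s₁ s₂ A₁ A₂ u₁ u₂ hu₁ hu₂ hgen c m hadm hZ hRow hRow₁ hRow₂ hRow₁₂)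

/-- **Deficit-MIN at cap `c₀` at one `R₀ ≥ 3`** from the payer pool at cap `c₀` (`bilayerWallAt_of_payerBound`, table-independent). -/
theorem deficitMinCharged_of_pool {c₀ R₀ : ℝ} (hR3 : 3 ≤ R₀) (h : ∃ C : ℝ, HStripPayerPoolAt c₀ C R₀) :
    ∃ C : ℝ, BilayerWallDeficitMinAt c₀ C R₀ := by
  obtain ⟨C, hpool⟩ := h
  refine ⟨(C + 3456 + 1152 * (R₀ + 1)) / 2, ?_⟩
  intro σ₁ σ₂ hσ₁ hσ₂ L₁ L₂ s₁ s₂ A₁ A₂ u₁ u₂ hA₁ hA₂ hgen c m hadm hZ hR₁ hR₂ hR₃' hR₄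
  exact bilayerWallAt_of_payerBound hσ₁ hσ₂ L₁ L₂ s₁ s₂ R₀ C hR3 c
    (hpool σ₁ σ₂ hσ₁ hσ₂ L₁ L₂ s₁ s₂ A₁ A₂ u₁ u₂ hA₁ hA₂ hgen c m hadm hZ hR₁ hR₂ hR₃' hR₄)

/-- **Generic part + residual part at cap `c₀` at one `R₀ ≥ 1` ⇒ the wall law at cap `c₀`.** -/
theorem bilayerWallCharged_of_splitAt {c₀ R₀ C₁ C₂ : ℝ} (hR₀1 : 1 ≤ R₀) (hC₁ : BilayerWallGenericAt c₀ C₁ R₀)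
    (hC₂ : BilayerWallResidualAt c₀ C₂ R₀) : BilayerWallCharged c₀ := by
  classical
  refine ⟨max C₁ C₂, R₀, hR₀1, ?_⟩
  intro σ₁ σ₂ hσ₁ hσ₂ L₁ L₂ s₁ s₂ A₁ A₂ hA₁ hA₂ c m hc0 hc1 hc2 hc3
  choose u₁ hu₁ using hA₁
  choose u₂ hu₂ using hA₂
  have hadm : BilayerChargeAdmissibleAt c₀ A₁ A₂ c m := ⟨hc0, hc1, hc2, hc3⟩
  by_cases hres : ∃ i j : ℤ, InResidualClass (A₁ i) (A₂ j) (u₁ i) (u₂ j)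
  · exact bilayerWallAt_mono (by linarith) (le_max_right _ _)
      (hC₂ σ₁ σ₂ hσ₁ hσ₂ L₁ L₂ s₁ s₂ A₁ A₂ u₁ u₂ hu₁ hu₂ hres c m hadm)
  · push Not at hres
    exact bilayerWallAt_mono (by linarith) (le_max_left _ _)
      (hC₁ σ₁ σ₂ hσ₁ hσ₂ L₁ L₂ s₁ s₂ A₁ A₂ u₁ u₂ hu₁ hu₂ (fun i j => hres i j) c m hadm)

/-! ## The whole composition at cap `c₀` at one thickness -/

/-- **The wall law at cap `c₀ ≤ 1` from the v7 inputs at one `R₀ ≥ 10`**: E1-data (`sE`, `ExactOnly`) and the StarPairFar consequences,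
F-U (strong, law-free), (β-iii) at cap `c₀`, T-F2 at cap `c₀` (both keys), the h-strip payer pool at cap `c₀` and the residual at cap `c₀`. -/
theorem bilayerWallCharged_of_stubsAt
    {sE : E3} (hsE : sE ∈ fccSlots) (hcert : ExactOnly 0 (fccSlots.filter fun w => 0 < ⟪w, sE⟫_ℝ))
    (hDS : ∀ F₁ F₂ : E3 ≃ₗᵢ[ℝ] E3, DoubleStarCoaxialAt F₁ F₂) (hCP : CapPairCoaxial) {c₀ R₀ : ℝ} (hc₀ : c₀ ≤ 1) (h10 : 10 ≤ R₀)
    (hF : ∃ C : ℝ, CoaxialUnifAt C R₀) (hIII : ∃ C : ℝ, BilayerWallBetaIIIAt c₀ C R₀)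
    (hFault : (∃ C : ℝ, BilayerWallFaultedOnReachCoaxialAt c₀ C R₀) ∧ (∃ C : ℝ, BilayerWallFaultedZigCoaxialAt c₀ C R₀))
    (hPool : ∃ C : ℝ, HStripPayerPoolAt c₀ C R₀) (hRes : ∃ C : ℝ, BilayerWallResidualAt c₀ C R₀) : BilayerWallCharged c₀ := by
  have hR₀6 : 6 ≤ R₀ := by linarith
  have hR₀0 : 0 ≤ R₀ := by linarith
  have hfam := famCoaxialCharged_of_dispatch hsE hcert hDS hCP hc₀ h10 hF hIII hFault
  obtain ⟨C_O, hO⟩ := onReachAllCharged_of_classesAt hsE hcert hDS hCP hc₀ hR₀6 hfam.1 hfam.2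
  obtain ⟨C_W, hW⟩ := bilayerWallWalkerCoveredAt_of_F4 hsE hcert hDS hCP hR₀6
  obtain ⟨C_R, hR⟩ := bilayerWallRowCovFrom_framesApart hsE hcert hDS hCP R₀ hR₀6
  obtain ⟨C_D, hD⟩ := deficitMinCharged_of_pool (by linarith) hPool
  obtain ⟨C_X, hX⟩ := hRes
  exact bilayerWallCharged_of_splitAt (by linarith) (genericAt_of_four_min hc₀ hR₀0 hW hR hO hD) hX

/-! ## Law v5: the instances at `c₀ = 13/25` under the port memo's names -/

/-- `stub_famCoaxial` of TexShadow v7 at one `R₀ ≥ 10` (cap `13/25`). -/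
theorem famCoaxialAtV5_of_dispatch
    {s₀ : E3} (hs₀ : s₀ ∈ fccSlots) (hcert : ExactOnly 0 (fccSlots.filter fun w => 0 < ⟪w, s₀⟫_ℝ))
    (hDS : ∀ G₁ G₂ : E3 ≃ₗᵢ[ℝ] E3, DoubleStarCoaxialAt G₁ G₂) (hCP : CapPairCoaxial) {R₀ : ℝ} (h10 : 10 ≤ R₀)
    (hF : ∃ C : ℝ, CoaxialUnifAt C R₀) (hIII : ∃ C : ℝ, BilayerWallBetaIIIAt (13 / 25) C R₀)
    (hFault : (∃ C : ℝ, BilayerWallFaultedOnReachCoaxialAt (13 / 25) C R₀) ∧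
      (∃ C : ℝ, BilayerWallFaultedZigCoaxialAt (13 / 25) C R₀)) :
    (∃ C : ℝ, BilayerWallOnReachCoaxialAt (13 / 25) C R₀) ∧ (∃ C : ℝ, BilayerWallZigCoaxialAt (13 / 25) C R₀) :=
  famCoaxialCharged_of_dispatch hs₀ hcert hDS hCP (by norm_num) h10 hF hIII hFault

/-- `stub_bilayerWallOnReachAll` of TexShadow v7 at one `R₀ ≥ 6` (cap `13/25`) from the two co-axial classes. -/
theorem bilayerWallOnReachAllV5_of_classesAt
    {sE : E3} (hsE : sE ∈ fccSlots) (hcert : ExactOnly 0 (fccSlots.filter fun w => 0 < ⟪w, sE⟫_ℝ))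
    (hDS : ∀ F₁ F₂ : E3 ≃ₗᵢ[ℝ] E3, DoubleStarCoaxialAt F₁ F₂) (hCP : CapPairCoaxial) {R₀ : ℝ} (hR₀ : 6 ≤ R₀)
    (hC : ∃ C, BilayerWallOnReachCoaxialAt (13 / 25) C R₀) (hZC : ∃ C, BilayerWallZigCoaxialAt (13 / 25) C R₀) :
    ∃ C : ℝ, BilayerWallOnReachAllAt FramesApart (13 / 25) C R₀ :=
  onReachAllCharged_of_classesAt hsE hcert hDS hCP (by norm_num) hR₀ hC hZC

/-- `stub_bilayerWallDeficit` of TexShadow v7 at one `R₀ ≥ 3` (cap `13/25`) from the h-strip payer pool. -/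
theorem bilayerWallDeficitMinAtV5_of_pool {R₀ : ℝ} (hR3 : 3 ≤ R₀) (h : ∃ C : ℝ, HStripPayerPoolAt (13 / 25) C R₀) :
    ∃ C : ℝ, BilayerWallDeficitMinAt (13 / 25) C R₀ :=
  deficitMinCharged_of_pool hR3 h

/-- **`BilayerWallV5` from the TexShadow v7 inputs at one `R₀ ≥ 10`**: E1-data, the StarPairFar facts, F-U (`∃ C, CoaxialUnifAt C R₀`),
(β-iii) at `13/25`, T-F2 at `13/25` (both keys), the h-strip payer pool at `13/25`, the residual at `13/25`. -/
theorem bilayerWallV5_of_stubsAt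
    {sE : E3} (hsE : sE ∈ fccSlots) (hcert : ExactOnly 0 (fccSlots.filter fun w => 0 < ⟪w, sE⟫_ℝ))
    (hDS : ∀ F₁ F₂ : E3 ≃ₗᵢ[ℝ] E3, DoubleStarCoaxialAt F₁ F₂) (hCP : CapPairCoaxial) {R₀ : ℝ} (h10 : 10 ≤ R₀)
    (hF : ∃ C : ℝ, CoaxialUnifAt C R₀) (hIII : ∃ C : ℝ, BilayerWallBetaIIIAt (13 / 25) C R₀)
    (hFault : (∃ C : ℝ, BilayerWallFaultedOnReachCoaxialAt (13 / 25) C R₀) ∧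
      (∃ C : ℝ, BilayerWallFaultedZigCoaxialAt (13 / 25) C R₀))
    (hPool : ∃ C : ℝ, HStripPayerPoolAt (13 / 25) C R₀) (hRes : ∃ C : ℝ, BilayerWallResidualAt (13 / 25) C R₀) :
    BilayerWallV5 :=
  bilayerWallCharged_of_stubsAt hsE hcert hDS hCP (by norm_num) h10 hF hIII hFault hPool hRes

end Summit.Ventures.Crystal3D.Cruxes.TextureLiminf.TexShadow

end
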